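import Literature.NumberTheory.QuadraticFields.ThreeTorsion
import Literature.NumberTheory.EllipticCurves.HeegnerPoints
import Mathlib.NumberTheory.NumberField.Units.Basic
import HarnessLib

/-!
# Route `SchneiderFreeAdditiveX3` (K1 door), crux `GordTwoBranchIMC` (stmt-BirchSwinnertonDyer-19177):
# the `d_K = −3` sliver of the KY-read road is VOID at `p = 3`

Cell `bsd-schneider-ideate`, seat `bsd-schneider-door-c3` (prover, generation 7). Bookkeeping for the
hypothesis `hSliver` of `gordTwoBranchIMC_of_facts_of_KY_OPEN` (sibling file `…GordTwoBranchIMCOfKY`):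
Keller–Yin's standing Assumption 2.0.3 excludes `K = ℚ(√−3)` (`d_K ≠ −3`), so the KY-reading of
crux r3 keeps the old bundled input on the sockets with `d_K = −3`. At `p = 3` — 2 411 of the cell's
2 560 pairs — those sockets are EMPTY: the socket carries `p ∤ #(𝓞_K^×)_tors`, while a quadratic field
of discriminant `−3` contains a primitive cube root of unity `ζ = (−1 + √−3)/2`, so `3 ∣ #(𝓞_K^×)_tors`
(`three_dvd_torsionOrder_of_discr_eq_neg_three`). Hence `hSliver` has content only at `p ≥ 5`
(149 pairs, the single field `ℚ(√−3)`). Fact-free; nothing asserted about BSD.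

References: Cox, *Primes of the form x² + ny²*, §7.A (units of imaginary quadratic orders);
Keller–Yin arXiv:2410.23241 Assumption 2.0.3.
-/

noncomputable section

open scoped Classical NumberField

open Polynomial NumberField Literature.NumberTheory.EllipticCurves

-- D-0017 layout: summit = sub-problem, so `Summit.BirchSwinnertonDyer.BirchSwinnertonDyer.…` is the
-- mandated namespace (same option as the route's sockets files).
set_option linter.dupNamespace false
set_option autoImplicit false

namespace Summit.BirchSwinnertonDyer.BirchSwinnertonDyer.Theorems.SchneiderFree

/-- **`ℚ(√−3)` has a unit of order `3`**: if `[K : ℚ] = 2` and `d_K = −3` then `3 ∣ #(𝓞_K^×)_tors`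
(`ζ = (√−3 − 1)/2` is an algebraic integer with `ζ³ = 1 ≠ ζ`). [cite: Cox2013, §7.A Thm. 7.2 and Lemma 7.5 (units of imaginary quadratic orders)] -/
theorem three_dvd_torsionOrder_of_discr_eq_neg_three {K : Type} [Field K] [NumberField K]
    (h2 : Module.finrank ℚ K = 2) (hd : NumberField.discr K = -3) :
    3 ∣ Units.torsionOrder K := by
  obtain ⟨θ, hθ, hθ2⟩ := Literature.NumberTheory.QuadraticFields.Quadratic.exists_not_mem_range_sq_eq_discr h2
  have hθ2' : θ ^ 2 = -3 := by
    rw [hθ2, hd]; push_cast; norm_num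
  set ζ : K := (θ - 1) / 2 with hζ
  have hθζ : θ = 2 * ζ + 1 := by rw [hζ]; ring
  have hζrel : ζ ^ 2 + ζ + 1 = 0 := by
    have h4 : (4 : K) ≠ 0 := by norm_num
    apply mul_left_cancel₀ h4
    have : 4 * (ζ ^ 2 + ζ + 1) = θ ^ 2 + 3 := by rw [hθζ]; ring
    rw [this, hθ2', mul_zero]; ring
  have hζ3 : ζ ^ 3 = 1 := by
    have : ζ ^ 3 - 1 = (ζ - 1) * (ζ ^ 2 + ζ + 1) := by ring
    rw [← sub_eq_zero, this, hζrel, mul_zero]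
  have hζ1 : ζ ≠ 1 := by
    intro h
    apply hθ
    exact ⟨3, by rw [hθζ, h, map_ofNat]; norm_num⟩
  -- `ζ` is an algebraic integer, hence a unit of `𝓞 K` of order `3`
  have hint : IsIntegral ℤ ζ :=
    IsIntegral.of_pow (by norm_num : 0 < 3) (by rw [hζ3]; exact isIntegral_one)
  set z : 𝓞 K := ⟨ζ, (mem_integralClosure_iff ℤ K).mpr hint⟩ with hz
  have hzζ : (z : K) = ζ := rfl
  have hz3 : z ^ 3 = 1 := by
    apply RingOfIntegers.coe_injective
    push_cast
    convert hζ3 using 2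
  set u : (𝓞 K)ˣ := Units.ofPowEqOne z 3 hz3 (by norm_num) with hu
  have hu3 : u ^ 3 = 1 := Units.pow_ofPowEqOne _ _
  have hu1 : u ≠ 1 := by
    intro h
    have h' : (u : 𝓞 K) = 1 := by rw [h, Units.val_one]
    rw [hu, Units.val_ofPowEqOne] at h'
    apply hζ1
    rw [← hzζ, h']
    rfl
  have horder : orderOf u = 3 := orderOf_eq_prime hu3 hu1
  have hfin : IsOfFinOrder u := isOfFinOrder_iff_pow_eq_one.mpr ⟨3, by norm_num, hu3⟩
  have hmem : u ∈ Units.torsion K := by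
    show u ∈ CommGroup.torsion (𝓞 K)ˣ
    exact hfin
  have hdvd := orderOf_dvd_natCard (⟨u, hmem⟩ : Units.torsion K)
  have hco := orderOf_injective (Units.torsion K).subtype Subtype.coe_injective ⟨u, hmem⟩
  change orderOf u = orderOf (⟨u, hmem⟩ : Units.torsion K) at hco
  rw [← hco, horder] at hdvd
  exact hdvd

/-- **The `d_K = −3` sockets are void at `p = 3`.** The socket's `p ∤ #(𝓞_K^×)_tors` and
`d_K = −3` are contradictory for `p = 3` — so the hypothesis `hSliver` of
`gordTwoBranchIMC_of_facts_of_KY_OPEN` is dischargeable `ex falso` on 2 411 of the cell's 2 560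
pairs, and has content only at `p ≥ 5` with `K = ℚ(√−3)`. [cite: KellerYin2024b, Assumption 2.0.3 (arXiv:2410.23241 p. 8)] -/
theorem sliver_void_at_three {K : Type} [Field K] [NumberField K] (hK : IsImaginaryQuadratic K)
    (hd : NumberField.discr K = -3) {p : ℕ} (hp3 : p = 3) (hunit : ¬ p ∣ Units.torsionOrder K) :
    False := by
  subst hp3
  exact hunit (three_dvd_torsionOrder_of_discr_eq_neg_three hK.1 hd)

end Summit.BirchSwinnertonDyer.BirchSwinnertonDyer.Theorems.SchneiderFree

end
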